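import Mathlib
import Summits.Ventures.PercRepro2.TwoHullMasterCube

/-!
# The cube-block principle for the two-hull master statement (MM) (blind cell PercRepro2,
night-4 g40, 2026-08-29; proofs/NIGHT4-G40.md §1)

A MONOTONE CUBE BLOCK for the marks `l`, `h` (`CubeBlock ends l h pt`): an injective map `pt` from
a Boolean cube `ι → Bool` to configurations with no monochromatic `l`–`h` connection, along which
the hull pair of `l` is monotone (in the product order of the cube) and the hull pair of `h`
antitone, and which mirrors the hull pair of `l` — or the hull pair of `h` — at the antipode.  On
such a block Mathlib's FKG inequality on the cube (`cube_sum_nonpos`, TwoHullMasterCube.lean) gives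
`Σ_block X·Y ≤ 0` for every pair of up-sets (`CubeBlock.sum_phiG_nonpos`).  A CUBE COVER
(`CubeCover`) — a finite family of blocks whose images partition `U = {h ∉ H_l}` — therefore gives
(MM): **`twoHullMaster_of_cubeCover`**.

Unlike the cube sides of TwoHullMasterCube.lean (one action of one cube on all of `U`, the hull
pairs unions of sub-pairs), a cube cover may use blocks of different dimensions, with arbitrary edge
classes and no group structure: only the monotonicity of the two hull pairs along each block and
the mirror at its antipode are used.  The census behind it (mining/night-4/g40/): on the triangular
prism with `l`, `h` in different triangles no cover by the arm cubes of NIGHT4-G10 (vertex-set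
flips, any frame) exists — not even a fractional one — while `U` (38 points) is the disjoint union
of 9 cube blocks with edge-set classes; TwoHullMasterBlockCheck.lean verifies such a cover on an
explicit graph by a kernel computation and TwoHullMasterPrism.lean lands the prism.

* `CubeBlock`, `CubeBlock.sum_phiG_nonpos`;
* `CubeCover`, **`twoHullMaster_of_cubeCover`**.
-/

namespace Summit.Ventures.PercRepro2

namespace Blocks

open Hull LocRows Path2 Glue2

open scoped Classical

variable {V : Type*} {E : Type*}

/-! ## §1 Monotone cube blocks -/

/-- **A monotone cube block**: an injective map from the cube `ι → Bool` into `U = {h ∉ H_l}`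
along which the hull pair of `l` is monotone and the hull pair of `h` antitone, mirroring the pair
of `l` or the pair of `h` at the antipode. -/
structure CubeBlock (ends : E → Sym2 V) (l h : V) {ι : Type*} (pt : (ι → Bool) → Config E) :
    Prop where
  /-- The points of the block are distinct configurations. -/
  inj : Function.Injective pt
  /-- Every point lies in `U`. -/
  mem : ∀ ε, h ∉ hull ends (pt ε) l
  /-- The hull pair of `l` is monotone along the cube. -/
  l_mono : ∀ ⦃ε ε' : ι → Bool⦄, ε ≤ ε' → PairLE (hullPair ends (pt ε) l) (hullPair ends (pt ε') l)
  /-- The hull pair of `h` is antitone along the cube. -/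
  h_anti : ∀ ⦃ε ε' : ι → Bool⦄, ε ≤ ε' → PairLE (hullPair ends (pt ε') h) (hullPair ends (pt ε) h)
  /-- The antipode mirrors the hull pair of `l`, or the hull pair of `h`. -/
  mirror : (∀ ε, hullPair ends (pt (cubeNot ε)) l = (hullPair ends (pt ε) l).swap) ∨
    (∀ ε, hullPair ends (pt (cubeNot ε)) h = (hullPair ends (pt ε) h).swap)

variable {ends : E → Sym2 V} {l h : V} {ι : Type*} {pt : (ι → Bool) → Config E}

/-- The antipode map is antitone. -/
lemma cubeNot_le_cubeNot {ε ε' : ι → Bool} (hle : ε ≤ ε') : cubeNot ε' ≤ cubeNot ε := by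
  intro j
  have := hle j
  simp only [cubeNot]
  revert this
  cases ε j <;> cases ε' j <;> simp

/-- The antipode map as a permutation of the cube. -/
def cubeNotPerm : Equiv.Perm (ι → Bool) := Function.Involutive.toPerm cubeNot cubeNot_cubeNot

/-- The antipode permutation acts by `cubeNot`. -/
lemma cubeNotPerm_apply (ε : ι → Bool) : (cubeNotPerm : Equiv.Perm (ι → Bool)) ε = cubeNot ε := rfl

/-- **The block inequality**: on a monotone cube block, `Σ X·Y ≤ 0` for every pair of up-sets. -/
theorem CubeBlock.sum_phiG_nonpos [Fintype ι] (hb : CubeBlock ends l h pt)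
    {𝓦l 𝓦h : Set (Set V × Set V)} (h𝓦l : IsPairUpSet 𝓦l) (h𝓦h : IsPairUpSet 𝓦h) :
    ∑ ε, phiG ends l h 𝓦l 𝓦h (pt ε) ≤ 0 := by
  set X : (ι → Bool) → ℤ := fun ε => sgn 𝓦l (hullPair ends (pt ε) l) with hX
  set Y : (ι → Bool) → ℤ := fun ε => sgn 𝓦h (hullPair ends (pt ε) h) with hY
  have hphi : ∀ ε, phiG ends l h 𝓦l 𝓦h (pt ε) = X ε * Y ε := fun ε => rfl
  simp_rw [hphi]
  have hXmono : Monotone X := fun ε ε' hle => sgn_mono h𝓦l (hb.l_mono hle)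
  have hYanti : Antitone Y := fun ε ε' hle => sgn_mono h𝓦h (hb.h_anti hle)
  rcases hb.mirror with hm | hm
  · -- the pair of `l` is mirrored: `X ∘ cubeNot` is antitone and odd, `Y ∘ cubeNot` monotone
    have hodd : ∀ ε, X (cubeNot ε) = - X ε := by
      intro ε
      simp only [hX, hm ε, sgn_swap]
    have key := cube_sum_nonpos (fun ε => X (cubeNot ε)) (fun ε => Y (cubeNot ε))
      (fun ε ε' hle => hXmono (cubeNot_le_cubeNot hle))
      (fun ε ε' hle => hYanti (cubeNot_le_cubeNot hle))
      (fun ε => by simp only [cubeNot_cubeNot, hodd ε, neg_neg])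
      (fun ε => sgn_le_one _ _) (fun ε => neg_one_le_sgn _ _)
    have hre : ∑ ε, X (cubeNot ε) * Y (cubeNot ε) = ∑ ε, X ε * Y ε :=
      Equiv.sum_comp (cubeNotPerm : Equiv.Perm (ι → Bool)) (fun ε => X ε * Y ε)
    simpa [hre] using key
  · -- the pair of `h` is mirrored: `Y` is antitone and odd, `X` monotone
    have hodd : ∀ ε, Y (cubeNot ε) = - Y ε := by
      intro ε
      simp only [hY, hm ε, sgn_swap]
    have key := cube_sum_nonpos Y X hYanti hXmono hodd (fun ε => sgn_le_one _ _)
      (fun ε => neg_one_le_sgn _ _)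
    simpa only [mul_comm] using key

/-! ## §2 Cube covers and the theorem -/

/-- **A cube cover of `U`**: a family of monotone cube blocks whose images partition
`U = {h ∉ H_l}`. -/
structure CubeCover (ends : E → Sym2 V) (l h : V) {β : Type*} {ι : β → Type*}
    (pt : ∀ b, (ι b → Bool) → Config E) : Prop where
  /-- Every member is a monotone cube block. -/
  block : ∀ b, CubeBlock ends l h (pt b)
  /-- Every configuration of `U` lies in some block. -/
  cover : ∀ ζ : Config E, h ∉ hull ends ζ l → ∃ b ε, pt b ε = ζ
  /-- Two blocks sharing a configuration are the same block. -/
  disj : ∀ b b' ε ε', pt b ε = pt b' ε' → b = b'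

variable {β : Type*} {ιb : β → Type*} {ptb : ∀ b, (ιb b → Bool) → Config E}

/-- `U` is the union of the images of the blocks of a cover. -/
lemma uClass_eq_biUnion [Fintype E] [DecidableEq E] [Fintype β] [∀ b, Fintype (ιb b)]
    (hc : CubeCover ends l h ptb) :
    uClass ends l h = Finset.univ.biUnion fun b => Finset.univ.image (ptb b) := by
  ext ζ
  simp only [mem_uClass, Finset.mem_biUnion, Finset.mem_univ, true_and, Finset.mem_image]
  constructor
  · intro hζ
    exact hc.cover ζ hζ
  · rintro ⟨b, ε, rfl⟩
    exact (hc.block b).mem ε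

/-- **(MM) from a cube cover.** -/
theorem twoHullMaster_of_cubeCover [Fintype E] [DecidableEq E] [Fintype β] [∀ b, Fintype (ιb b)]
    (hc : CubeCover ends l h ptb) : TwoHullMaster ends l h := by
  refine twoHullMaster_of_sum_nonpos l h fun 𝓦l 𝓦h h𝓦l h𝓦h => ?_
  rw [uClass_eq_biUnion hc]
  rw [Finset.sum_biUnion]
  · refine Finset.sum_nonpos fun b _ => ?_
    rw [Finset.sum_image fun ε _ ε' _ hεε' => (hc.block b).inj hεε']
    exact (hc.block b).sum_phiG_nonpos h𝓦l h𝓦h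
  · intro b _ b' _ hbb'
    rw [Function.onFun, Finset.disjoint_left]
    rintro ζ hζ hζ'
    rw [Finset.mem_image] at hζ hζ'
    obtain ⟨ε, _, rfl⟩ := hζ
    obtain ⟨ε', _, hε'⟩ := hζ'
    exact hbb' (hc.disj b b' ε ε' hε'.symm)

end Blocks

end Summit.Ventures.PercRepro2
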